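import Literature.Computability.AlgebraicComplexity.EvenCycleCoverVNPWitness
import Literature.Computability.AlgebraicComplexity.DetInVP
import Literature.Computability.AlgebraicComplexity.HamiltonianCycleVNP
import Literature.RingTheory.MvPolynomial.PowerSumSurjective
import Literature.LinearAlgebra.Matrix.ColouringSum
import Literature.LinearAlgebra.Matrix.MvPolynomialDetDegree
import HarnessLib

/-!
# The signed even-cycle-cover family is in `VNP`

With the witness `ecWitness` of `EvenCycleCoverVNPWitness.lean` (`boolSum_ecWitness_eq`) and the
cycle-type formula for colouring sums (`Literature.LinearAlgebra.Matrix.colouringSum_eq_prod_cycleType`,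
specialised here to the indicator of "fixed-point free with all cycles even",
`colouringSum_eq_ite_even`) we identify its Boolean sum with `D^even_n`
(`boolSum_ecWitness : ∑_{e ∈ {0,1}^{2n²}} ecWitness(X, e) = D^even_n(X)`), bound its number of
variables (`3n²`), degree (`≤ 12 (n+1)³`, with the Leibniz bound
`Literature.LinearAlgebra.Matrix.totalDegree_det_le`) and complexity (`≤ 45 (n+1)⁷`, the
determinant of the coloured matrix being one substitution instance of `DET_n ∈ VP`,
`complexity_detPoly_le`, Berkowitz), choose transfer weights `γ` with `2 ∑_s γ_s^m = 1` for `1 ≤ m ≤ n`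
(`Literature.RingTheory.MvPolynomial.exists_powerSum_eq`, algebraically closed field of
characteristic zero), and conclude

* `isVNPFamily_evenCycleCoverPoly` — `(D^even_n)_n ∈ VNP` (Bürgisser 2000, Def. 2.5) over every
  algebraically closed field of characteristic zero, in particular over `ℂ`;
* `evenCycleCoverFamily_mem_VNP` — the bundled form.

This is the instance of Valiant's criterion (Valiant 1979; Bürgisser 2000, Prop. 2.20) for the
class function `sgn · [Π^even]`, proved here by the colouring/determinant witness rather than by
Boolean circuits.

## References

* L. G. Valiant, *Completeness classes in algebra*, STOC 1979, §4.
* P. Bürgisser, *Completeness and Reduction in Algebraic Complexity Theory*, Springer 2000,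
  Def. 2.3–2.5, Prop. 2.20, Prop. 2.30.
-/

noncomputable section

open MvPolynomial Equiv Finset

universe u

namespace Literature.Computability.AlgebraicComplexity

/-! ### The Boolean sum of the witness is `D^even_n` -/

section Indicator

variable {α : Type*} [Fintype α] [DecidableEq α] {K : Type*} [Fintype K] [DecidableEq K]
  {R : Type*} [CommRing R]

/-- Products of `0/1`-indicators over a multiset. [folklore] -/
theorem multiset_prod_map_ite_eq {β : Type*} (s : Multiset β) (p : β → Prop) [DecidablePred p] :
    (s.map fun b => if p b then (1 : R) else 0).prod = if ∀ b ∈ s, p b then 1 else 0 := by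
  induction s using Multiset.induction_on with
  | empty => simp
  | cons a s ih =>
    rw [Multiset.map_cons, Multiset.prod_cons, ih]
    by_cases ha : p a <;> simp [ha]

/-- **Indicator of "fixed-point free with all cycles even".** If `tr (W ^ ℓ) = [ℓ even]` for
`1 ≤ ℓ ≤ #α`, then `∑_κ ∏ᵢ W (κ i) (κ (σ i))` is `1` if `σ` has no fixed point and all its cycles
have even length, and `0` otherwise (`colouringSum_eq_prod_cycleType`,
`colouringSum_eq_zero_of_apply_eq`). [folklore] -/
theorem colouringSum_eq_ite_even (W : Matrix K K R)
    (hW : ∀ ℓ, 1 ≤ ℓ → ℓ ≤ Fintype.card α → (W ^ ℓ).trace = if Even ℓ then 1 else 0)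
    (σ : Perm α) :
    Literature.LinearAlgebra.Matrix.colouringSum W σ =
      if (∀ i, σ i ≠ i) ∧ (∀ ℓ ∈ σ.cycleType, Even ℓ) then 1 else 0 := by
  by_cases hfix : ∀ i, σ i ≠ i
  · have hsupp : σ.support = univ := by
      ext i
      simp [Perm.mem_support, hfix i]
    rw [Literature.LinearAlgebra.Matrix.colouringSum_eq_prod_cycleType W hsupp]
    have hℓ : ∀ ℓ ∈ σ.cycleType, (W ^ ℓ).trace = if Even ℓ then 1 else 0 := fun ℓ hℓ =>
      hW ℓ (by have := Perm.two_le_of_mem_cycleType hℓ; omega)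
        ((Multiset.le_sum_of_mem hℓ).trans
          (by rw [Perm.sum_cycleType]; exact Finset.card_le_univ _))
    rw [Multiset.map_congr rfl hℓ, multiset_prod_map_ite_eq]
    by_cases hev : ∀ ℓ ∈ σ.cycleType, Even ℓ
    · rw [if_pos hev, if_pos ⟨hfix, hev⟩]
    · rw [if_neg hev, if_neg fun h => hev h.2]
  · push Not at hfix
    obtain ⟨x, hx⟩ := hfix
    have h1 : W.trace = 0 := by
      have := hW 1 le_rfl (Fintype.card_pos_iff.2 ⟨x⟩)
      simpa using this
    rw [Literature.LinearAlgebra.Matrix.colouringSum_eq_zero_of_apply_eq W h1 hx, if_neg]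
    rintro ⟨h, -⟩
    exact h x hx

end Indicator

section BoolSum

variable {n : ℕ} {k : Type u} [CommRing k]

/-- **The Boolean sum of the witness is the signed even-cycle-cover polynomial** as soon as the
transfer weights satisfy `2 ∑_s γ_s ^ m = 1` for `1 ≤ m ≤ n`. [cite: Burgisser2000, Prop. 2.20] -/
theorem boolSum_ecWitness (γ : Fin n → k) (hγ : ∀ m, 1 ≤ m → m ≤ n → 2 * ∑ s, γ s ^ m = 1) :
    boolSum (ecWitness k γ) = evenCycleCoverPoly n k := by
  rw [boolSum_ecWitness_eq]
  unfold evenCycleCoverPoly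
  refine Finset.sum_congr rfl fun σ _ => ?_
  have h := colouringSum_eq_ite_even (transferMatrix γ)
    (fun ℓ h1 h2 => trace_transferMatrix_pow γ hγ ℓ h1 (by simpa using h2)) σ
  unfold Literature.LinearAlgebra.Matrix.colouringSum at h
  rw [h]
  congr 2
  split_ifs <;> simp

end BoolSum

/-! ### Degree bounds -/

section Degree

variable {n : ℕ} {k : Type u} [CommRing k]

/-- `deg Z_p ≤ 1`. [folklore] -/
theorem totalDegree_zVar_le (p : Fin n × (Fin n × Fin 2)) : (zVar n k p).totalDegree ≤ 1 :=
  totalDegree_X_le_one _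

/-- The number of ordered pairs of distinct colours is at most `(2n)²`. [folklore] -/
theorem card_colourPairs_le (n : ℕ) :
    ((univ : Finset ((Fin n × Fin 2) × (Fin n × Fin 2))).filter (fun ab => ab.1 ≠ ab.2)).card ≤
      (n * 2) * (n * 2) := by
  refine (Finset.card_filter_le _ _).trans ?_
  simp [Finset.card_univ]

/-- `deg (recogniser) ≤ 8 n³ + n`. [cite: BurgisserClausenShokrollahi1997, Prop. (21.15)] -/
theorem totalDegree_ecRecogniser_le :
    (ecRecogniser n k).totalDegree ≤ n * ((n * 2) * (n * 2) * 2) + n * 1 := by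
  unfold ecRecogniser
  refine (totalDegree_mul _ _).trans (Nat.add_le_add ?_ ?_)
  · refine (totalDegree_prod_le_of_le _ _ ((n * 2) * (n * 2) * 2) fun i _ => ?_).trans
      (by rw [Finset.card_univ, Fintype.card_fin])
    refine (totalDegree_prod_le_of_le _ _ 2 fun ab _ => ?_).trans
      (Nat.mul_le_mul_right 2 (card_colourPairs_le n))
    unfold zVar
    exact totalDegree_one_sub_X_mul_X_le _ _
  · refine (totalDegree_prod_le_of_le _ _ 1 fun i _ => ?_).trans
      (by rw [Finset.card_univ, Fintype.card_fin])
    exact totalDegree_sum_le_of_le _ _ _ fun a _ => totalDegree_zVar_le _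

/-- Entries of the coloured matrix have degree `≤ 3`. [folklore] -/
theorem totalDegree_ecMatrix_le (γ : Fin n → k) (j i : Fin n) :
    (ecMatrix k γ j i).totalDegree ≤ 3 := by
  simp only [ecMatrix, Matrix.of_apply]
  refine (totalDegree_mul _ _).trans ?_
  refine Nat.add_le_add (totalDegree_sum_le_of_le _ _ 2 fun a _ =>
    totalDegree_sum_le_of_le _ _ 2 fun b _ => ?_) (totalDegree_X_le_one _)
  refine (totalDegree_mul _ _).trans ?_
  rw [totalDegree_C, add_zero]
  exact (totalDegree_mul _ _).trans (Nat.add_le_add (totalDegree_zVar_le _) (totalDegree_zVar_le _))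

/-- `deg (ecWitness) ≤ 12 (n+1)³`. [cite: Burgisser2000, Prop. 2.20] -/
theorem totalDegree_ecWitness_le (γ : Fin n → k) :
    (ecWitness k γ).totalDegree ≤ 12 * (n + 1) ^ 3 := by
  unfold ecWitness
  refine (totalDegree_mul _ _).trans ?_
  have h1 := totalDegree_ecRecogniser_le (n := n) (k := k)
  have h2 : (ecMatrix k γ).det.totalDegree ≤ ∑ _c : Fin n, 3 :=
    Literature.LinearAlgebra.Matrix.totalDegree_det_le _ (fun _ => 3)
      fun i j => totalDegree_ecMatrix_le γ i j
  rw [Finset.sum_const, Finset.card_univ, Fintype.card_fin, smul_eq_mul] at h2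
  have e3 : (n + 1) ^ 3 = (n + 1) * (n + 1) * (n + 1) := by ring
  nlinarith

end Degree

/-! ### Complexity bounds -/

section Cost

variable {n : ℕ} {k : Type u} [CommRing k]

/-- `L(Z Z' · c) ≤ 2` (inputs and constants are free). [cite: BurgisserClausenShokrollahi1997, Def. (21.3)] -/
theorem complexity_zVar_mul_zVar_mul_C_le (p q : Fin n × (Fin n × Fin 2)) (c : k) :
    complexity (zVar n k p * zVar n k q * C c) ≤ 2 := by
  have h1 := complexity_mul_le_holds (zVar n k p * zVar n k q) (C c)
  have h2 := complexity_mul_le_holds (zVar n k p) (zVar n k q)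
  have h3 : complexity (zVar n k p) = 0 := complexity_X_holds _
  have h4 : complexity (zVar n k q) = 0 := complexity_X_holds _
  have h5 := complexity_C_holds (σ := ECVars n) c
  omega

/-- `L(recogniser) ≤ 16 n³ + n + (2 n² + n) + 1`. [cite: BurgisserClausenShokrollahi1997, Prop. (21.15)] -/
theorem complexity_ecRecogniser_le :
    complexity (ecRecogniser n k) ≤
      (n * ((n * 2) * (n * 2) * 3 + (n * 2) * (n * 2)) + n) +
        (n * ((n * 2) * 0 + n * 2) + n) + 1 := by
  unfold ecRecogniser
  refine (complexity_mul_le_holds _ _).trans (Nat.add_le_add_right (Nat.add_le_add ?_ ?_) 1)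
  · refine (complexity_prod_le_of_le _ _ ((n * 2) * (n * 2) * 3 + (n * 2) * (n * 2))
      fun i _ => ?_).trans (by rw [Finset.card_univ, Fintype.card_fin])
    refine (complexity_prod_le_of_le _ _ 3 fun ab _ => ?_).trans ?_
    · unfold zVar
      exact complexity_one_sub_X_mul_X_le _ _
    · have h := card_colourPairs_le n
      gcongr
  · refine (complexity_prod_le_of_le _ _ ((n * 2) * 0 + n * 2) fun i _ => ?_).trans
      (by rw [Finset.card_univ, Fintype.card_fin])
    refine (complexity_sum_le_of_le _ _ 0 fun a _ => le_of_eq (complexity_X_holds _)).trans ?_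
    rw [Finset.card_univ, Fintype.card_prod, Fintype.card_fin, Fintype.card_fin]

/-- Entries of the coloured matrix: `L ≤ 12 n² + 2 n + 1`. [folklore] -/
theorem complexity_ecMatrix_le (γ : Fin n → k) (j i : Fin n) :
    complexity (ecMatrix k γ j i) ≤ ((n * 2) * ((n * 2) * 2 + n * 2) + n * 2) + 0 + 1 := by
  simp only [ecMatrix, Matrix.of_apply]
  refine (complexity_mul_le_holds _ _).trans (Nat.add_le_add_right (Nat.add_le_add ?_
    (le_of_eq (complexity_X_holds _))) 1)
  refine (complexity_sum_le_of_le _ _ ((n * 2) * 2 + n * 2) fun a _ => ?_).trans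
    (by rw [Finset.card_univ, Fintype.card_prod, Fintype.card_fin, Fintype.card_fin])
  refine (complexity_sum_le_of_le _ _ 2 fun b _ =>
    complexity_zVar_mul_zVar_mul_C_le _ _ _).trans ?_
  rw [Finset.card_univ, Fintype.card_prod, Fintype.card_fin, Fintype.card_fin]

/-- The determinant of the coloured matrix is a substitution instance of `DET_n`. [folklore] -/
theorem ecMatrix_det_eq_aeval (γ : Fin n → k) :
    (ecMatrix k γ).det = aeval (fun q : Fin n × Fin n => ecMatrix k γ q.1 q.2) (detPoly (Fin n) k) := by
  rw [detPoly, AlgHom.map_det, AlgHom.mapMatrix_apply]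
  congr 1
  ext i j
  simp [Matrix.mvPolynomialX_apply]

/-- `L(det of the coloured matrix) ≤ L(DET_n) + ∑ L(entries)` (Bürgisser 2000, Rem. 2.7, with
`DET ∈ VP` by Berkowitz). [cite: Burgisser2000, Prop. 2.30] -/
theorem complexity_ecMatrix_det_le (γ : Fin n → k) :
    complexity (ecMatrix k γ).det ≤
      8 * (n + 1) ^ 7 + n * n * (((n * 2) * ((n * 2) * 2 + n * 2) + n * 2) + 0 + 1) := by
  rw [ecMatrix_det_eq_aeval]
  refine (complexity_aeval_le _ _).trans (Nat.add_le_add (complexity_detPoly_le k n) ?_)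
  calc ∑ q : Fin n × Fin n, complexity (ecMatrix k γ q.1 q.2)
      ≤ ∑ _q : Fin n × Fin n, (((n * 2) * ((n * 2) * 2 + n * 2) + n * 2) + 0 + 1) :=
        Finset.sum_le_sum fun q _ => complexity_ecMatrix_le γ q.1 q.2
    _ = _ := by simp [Finset.card_univ]

/-- `L(ecWitness) ≤ 45 (n+1)⁷`. [cite: Burgisser2000, Prop. 2.20] -/
theorem complexity_ecWitness_le (γ : Fin n → k) :
    complexity (ecWitness k γ) ≤ 45 * (n + 1) ^ 7 := by
  unfold ecWitness
  refine (complexity_mul_le_holds _ _).trans ?_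
  have h1 := complexity_ecRecogniser_le (n := n) (k := k)
  have h2 := complexity_ecMatrix_det_le (k := k) γ
  have e7 : (n + 1) ^ 7 = (n + 1) * (n + 1) * (n + 1) * (n + 1) * (n + 1) * (n + 1) * (n + 1) := by
    ring
  nlinarith

end Cost

/-! ### The family and `VNP` membership -/

section Family

variable (k : Type u) [Field k] [IsAlgClosed k] [CharZero k]

/-- Transfer weights `γ` with `2 ∑_s γ_s ^ m = 1` for `1 ≤ m ≤ n`
(`Literature.RingTheory.MvPolynomial.exists_powerSum_eq`). [folklore] -/
def ecGamma (n : ℕ) : Fin n → k :=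
  Classical.choose (Literature.RingTheory.MvPolynomial.exists_powerSum_eq n fun _ => (2 : k)⁻¹)

/-- The defining property of `ecGamma`. [folklore] -/
theorem two_mul_sum_ecGamma_pow (n m : ℕ) (h1 : 1 ≤ m) (hm : m ≤ n) :
    2 * ∑ s, ecGamma k n s ^ m = 1 := by
  have h := Classical.choose_spec
    (Literature.RingTheory.MvPolynomial.exists_powerSum_eq n fun _ => (2 : k)⁻¹) m h1 hm
  unfold ecGamma
  rw [h]
  exact mul_inv_cancel₀ two_ne_zero

/-- The `VNP` witness family for `D^even`. [cite: Burgisser2000, Prop. 2.20] -/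
def ecVNPFamily (n : ℕ) : MvPolynomial ((Fin n × Fin n) ⊕ Fin (n * (n * 2))) k :=
  ecWitness k (ecGamma k n)

/-- **The witness family is in `VP`**: `3n²` variables, degree `≤ 12 (n+1)³`, complexity
`≤ 45 (n+1)⁷`. [cite: Burgisser2000, Prop. 2.20] -/
theorem isVPFamily_ecVNPFamily : IsVPFamily (ecVNPFamily k) := by
  refine ⟨⟨(IsPBounded.iff_exists_le_mul_succ_pow _).2 ⟨3, 2, fun n => ?_⟩,
    (IsPBounded.iff_exists_le_mul_succ_pow _).2 ⟨12, 3, fun n => ?_⟩⟩,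
    (IsPBounded.iff_exists_le_mul_succ_pow _).2 ⟨45, 7, fun n => ?_⟩⟩
  · simp only [Fintype.card_sum, Fintype.card_prod, Fintype.card_fin]
    nlinarith
  · exact totalDegree_ecWitness_le _
  · exact complexity_ecWitness_le _

/-- `D^even_n` has degree `≤ n`. [folklore] -/
theorem totalDegree_evenCycleCoverPoly_le (n : ℕ) {R : Type u} [CommRing R] :
    (evenCycleCoverPoly n R).totalDegree ≤ n := by
  unfold evenCycleCoverPoly
  refine totalDegree_sum_le_of_le _ _ _ fun σ _ => ?_
  refine (totalDegree_mul _ _).trans ?_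
  rw [totalDegree_C, zero_add]
  refine (totalDegree_prod_le_of_le _ _ 1 fun i _ => totalDegree_X_le_one _).trans ?_
  simp

/-- `(D^even_n)_n` is a p-family: `n²` variables, degree `≤ n`. [cite: Burgisser2000, Def. 2.3] -/
theorem isPFamily_evenCycleCoverPoly {R : Type u} [CommRing R] :
    IsPFamily fun n => evenCycleCoverPoly n R := by
  refine ⟨(IsPBounded.iff_exists_le_mul_succ_pow _).2 ⟨1, 2, fun n => ?_⟩,
    (IsPBounded.iff_exists_le_mul_succ_pow _).2 ⟨1, 1, fun n => ?_⟩⟩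
  · simp only [Fintype.card_prod, Fintype.card_fin]
    nlinarith
  · exact (totalDegree_evenCycleCoverPoly_le n).trans (by rw [pow_one]; omega)

/-- **`D^even ∈ VNP`**: the signed even-cycle-cover family
`D^even_n = ∑_{σ fixed-point free, all cycles even} sgn σ ∏ᵢ X_{σ i, i}` is p-definable over every
algebraically closed field of characteristic zero (Valiant's criterion, Valiant 1979; Bürgisser
2000, Prop. 2.20 — here by the explicit colouring/determinant witness `ecWitness`, Boolean sum of
length `2n²`). [cite: Burgisser2000, Prop. 2.20] -/
theorem isVNPFamily_evenCycleCoverPoly : IsVNPFamily fun n => evenCycleCoverPoly n k :=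
  ⟨isPFamily_evenCycleCoverPoly, fun n => n * (n * 2), ecVNPFamily k, isVPFamily_ecVNPFamily k,
    fun n => (boolSum_ecWitness (ecGamma k n) (two_mul_sum_ecGamma_pow k n)).symm⟩

/-- The bundled signed even-cycle-cover family lies in `VNP k` (`mem_VNP_ofFintype_iff_holds`).
[cite: Burgisser2000, Prop. 2.20] -/
theorem evenCycleCoverFamily_mem_VNP :
    PolyFamily.ofFintype (fun n => evenCycleCoverPoly n k) ∈ VNP k :=
  (mem_VNP_ofFintype_iff_holds _).2 (isVNPFamily_evenCycleCoverPoly k)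

end Family

end Literature.Computability.AlgebraicComplexity
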